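import Summits.QuantumFields.BalabanUV.Beta.FP.CompositeBorderTables
import Summits.QuantumFields.BalabanUV.Beta.FP.CompositeAveragingTablesLetters
import Summits.QuantumFields.BalabanUV.Beta.FP.CompositeAveragingTablesMixedLetters
import Summits.QuantumFields.BalabanUV.Beta.FP.CompositeAveragingTablesTranslate

/-!
# `BalabanUV.Beta.FP.CompositeBorderTablesLetters` — road «FP» for binder row D1, RULING **R-FP-50 (a)**: THE LETTERS OF THE COMPOSITE BORDER TABLES —
# `LocStencil (VComp … m)`, `LocStencil₂ (V₂Comp … m)` ∕ `LocStencil₂ (S₂Comp … m)` and the block-translation covariances (TV)∕(TB) at blocking `Lc^m`, from the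
# one-step letters, ONE decay letter of the one-step weight `q`, and D3's `vertexFamily_HComp` ∕ `locStencilFM_M2Comp` ∕ `HComp_translate` ∕ `M2Comp_translate` BY NAME
# through two RE-SLICING lemmas per order (`vertexFamily_rowsK` ∕ `locStencil_packK`, `locStencilFM_rowsK₂` ∕ `locStencil₂_packK₂`)

HONEST DEPENDENCY (page 1, mandatory): continuum YM on T⁴ ⇐ BetaPertH ∧ nine spine estimates (0/9 proved); BetaPertH ⇐ (D1) ∧ (D4) ∧ CAP+tail;
G-an2-4 gates asym, D1 and NE2/3/4.  HONEST FRAMING (cell contract, verbatim): «discharging `BetaPertH` makes Bałaban's UV stability UNCONDITIONAL —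
a real constructive-QFT result; it is NOT the continuum limit and NOT the Clay problem.»  ABSOLUTE RULE (cell charter, verbatim): «No internally-minted
statement may enter as a cited fact. Every hypothesis is either kernel-proved in this package or a verbatim quotation of a PUBLISHED theorem with page
reference. The manuscript(s) under audit are NOT citable for their own disputed steps — they are the thing under adjudication; programme-internal
(2001/route/tribunal) claims are never citable.»  THIS MODULE is [folklore] bookkeeping (triangle inequality for `ℓ¹`, re-indexing; D3's inductions BY NAME); no `def`,
no `def … : Prop`, nothing cited, 0 sorry.  Every rate ∕ letter below is a HYPOTHESIS SHAPE asserted for no object of Bałaban's.  0∕4 row-D1 binders; NOT the END re-base,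
NOT (J-S)(J-W), NOT SDF, NOT D1, NOT BetaPertH, NOT continuum, NOT Clay.  «not in print; our bookkeeping».

CONTENT (generic `d`; first-order inputs at ONE common rate `δ` — the one-step tables' letters hold at every ∕ some rate (`SymTables.hV`, `.hB`), weaken to the minimum first).
* §1 re-slicing: **`vertexFamily_rowsK`** (`LocStencil V C δ ⟹ VertexFamily (rowsK N V) N C (δ∕2)`), **`locStencil_packK`** (`VertexFamily T N C δ ⟹ LocStencil (packK N T) C (δ∕2)`),
  **`locStencilFM_rowsK₂`** (`LocStencil₂ B C δ ⟹ LocStencilFM N (rowsK₂ N B) C δ`), **`locStencil₂_packK₂`** (`LocStencilFM N T₂ C δ ⟹ LocStencil₂ (packK₂ N ε T₂) ((1+|ε|)·C) δ`);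
  translations `rowsK_translate`, `packK_translate` (an1's `packVH_translate`), `rowsK₂_translate`, `packK₂_translate`.
* §2 **`locStencil_VComp`** (`∃ C δ′ > 0`, every `m ≥ 1`), **`VComp_translate`** ((TV) at blocking `Lc^m`: `VComp … m κ (u + Lc^m•t) = shiftK (−Lc^m•t) (VComp … m κ u)`).
* §3 **`locStencil₂_V₂Comp`**, **`locStencil₂_S₂Comp`**, **`V₂Comp_translate`**, **`S₂Comp_translate`** ((TB) at blocking `Lc^m`).
Provenance: D1 formalisation swarm LEAF PROVER 02, unit b2b-balaban-beta-d1-formalise-leaf-02 gen 15, 2026-08-21 (R-FP-50 (a); INTENT 6).  No existing file touched.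
-/

noncomputable section

namespace Summit.QuantumFields.BalabanUV.Beta.FP.CompositeBorderTablesLetters

open Literature.MathematicalPhysics.QuantumFieldTheory.Balaban1983to89
open Literature.MathematicalPhysics.QuantumFieldTheory.Balaban1983to89.Beta
open B12Sec2to5 (l1 l1_nonneg)
open ExpKernelCalculus (MKer BiLoc VertexFamily shiftK l1_sub_triangle l1_sub_symm)
open AffineAveraging (Site)
open AveragingContours (blk off)
open AveragingHessianKernels (Bond packVH packVH_translate off_add_smul blk_add_smul)
open OneStepResolventKernel (Fib LocStencil biLoc_mono)
open BalabanStepJets (locStencil_mono)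
open BalabanCompositeJets (LocStencil₂ l1_zero')
open SecondOrderResponse (LocStencilFM biLoc_smul)
open KernelWard (biLoc_add biLoc_sub)
open BalabanStepW2 (biLoc_le_mono)
open Summit.QuantumFields.BalabanUV.Beta.FP.CompositeAveragingTablesInf (HComp M2Comp)
open Summit.QuantumFields.BalabanUV.Beta.FP.CompositeAveragingTablesLetters (vertexFamily_HComp)
open Summit.QuantumFields.BalabanUV.Beta.FP.CompositeAveragingTablesMixedLetters (locStencilFM_M2Comp)
open Summit.QuantumFields.BalabanUV.Beta.FP.CompositeAveragingTablesTranslate (HComp_translate M2Comp_translate)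
open Summit.QuantumFields.BalabanUV.Beta.FP.CompositeBorderTables

variable {d : ℕ}

/-! ## §1 Re-slicing and translating the unpacked ∕ packed tensors -/

section Reslice

variable {N : ℕ} {V : Fin (d + 1) → Site (d + 1) → MKer (d + 1) (Fib d)} {T : Fin (d + 1) → Site (d + 1) → MKer (d + 1) (Fib d)}
  {B : Fin (d + 1) → Site (d + 1) → Fin (d + 1) → Site (d + 1) → MKer (d + 1) (Fib d)}
  {T₂ : Fin (d + 1) → Site (d + 1) → Fin (d + 1) → Site (d + 1) → MKer (d + 1) (Fib d)} {C δ : ℝ}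

/-- [folklore] **A LOCAL STENCIL FAMILY, UNPACKED, IS A FIRST-ORDER VERTEX FAMILY** at half the rate: the entry `V κ u x (N•w)` is bounded by `C·e^{−δ(|x−u|₁+|N•w−u|₁)}
≤ C·e^{−(δ/2)(|u−N•w|₁+|x−N•w|₁)}` (triangle inequality). -/
theorem vertexFamily_rowsK (hV : LocStencil V C δ) (hδ : 0 ≤ δ) (N : ℕ) : VertexFamily (rowsK N V) N C (δ / 2) := by
  have hC : 0 ≤ C := (hV 0 0).nonneg (Sum.inl 0)
  intro ρ w u x a b
  have h0 : (0 : ℝ) ≤ C * Real.exp (-(δ / 2) * (l1 (u - (N : ℤ) • w) + l1 (x - (N : ℤ) • w))) := by positivity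
  rcases a with κ | ν
  · rcases b with α | ν'
    · rw [rowsK_inl_inl]
      refine (hV κ u x ((N : ℤ) • w) (Sum.inl α) (Sum.inr ρ)).trans (mul_le_mul_of_nonneg_left (Real.exp_le_exp.2 ?_) hC)
      have t1 : l1 (x - (N : ℤ) • w) ≤ l1 (x - u) + l1 (u - (N : ℤ) • w) := l1_sub_triangle x u _
      have e1 : l1 ((N : ℤ) • w - u) = l1 (u - (N : ℤ) • w) := l1_sub_symm _ _
      rw [e1]
      nlinarith [l1_nonneg (x - u), l1_nonneg (u - (N : ℤ) • w), l1_nonneg (x - (N : ℤ) • w)]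
    · rw [rowsK_inl_inr, abs_zero]; exact h0
  · rw [rowsK_inr, abs_zero]; exact h0

/-- [folklore] **A FIRST-ORDER VERTEX FAMILY, PACKED, IS A LOCAL STENCIL FAMILY** at half the rate (`1 ≤ N`): the fm entry at `(x, z)`, `z = N•w`, is `T ρ w u x`, bounded by
`C·e^{−δ(|u−z|₁+|x−z|₁)} ≤ C·e^{−(δ/2)(|x−u|₁+|z−u|₁)}`; the mf twin likewise; everything else is `0`. -/
theorem locStencil_packK (hT : VertexFamily T N C δ) (hδ : 0 ≤ δ) (hN : 1 ≤ N) : LocStencil (packK N T) C (δ / 2) := by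
  have hC : 0 ≤ C := (hT 0 0).nonneg (Sum.inl 0)
  intro κ u x z a b
  have h0 : (0 : ℝ) ≤ C * Real.exp (-(δ / 2) * (l1 (x - u) + l1 (z - u))) := by positivity
  rcases a with α | ρ <;> rcases b with α' | ρ'
  · rw [packK_inl_inl, abs_zero]; exact h0
  · rw [packK_inl_inr]
    split_ifs with hz
    · have ez : (N : ℤ) • blk N z = z := zsmul_blk_of_off_eq_zero hN hz
      have h := hT ρ' (blk N z) u x (Sum.inl κ) (Sum.inl α)
      rw [ez] at h
      refine h.trans (mul_le_mul_of_nonneg_left (Real.exp_le_exp.2 ?_) hC)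
      have t1 : l1 (x - u) ≤ l1 (x - z) + l1 (z - u) := l1_sub_triangle x z u
      have e1 : l1 (u - z) = l1 (z - u) := l1_sub_symm _ _
      rw [e1]
      nlinarith [l1_nonneg (x - z), l1_nonneg (z - u), l1_nonneg (x - u)]
    · rw [abs_zero]; exact h0
  · rw [packK_inr_inl]
    split_ifs with hx
    · have ex : (N : ℤ) • blk N x = x := zsmul_blk_of_off_eq_zero hN hx
      have h := hT ρ (blk N x) u z (Sum.inl κ) (Sum.inl α')
      rw [ex] at h
      refine h.trans (mul_le_mul_of_nonneg_left (Real.exp_le_exp.2 ?_) hC)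
      have t1 : l1 (z - u) ≤ l1 (z - x) + l1 (x - u) := l1_sub_triangle z x u
      have e1 : l1 (u - x) = l1 (x - u) := l1_sub_symm _ _
      rw [e1]
      nlinarith [l1_nonneg (z - x), l1_nonneg (x - u), l1_nonneg (z - u)]
    · rw [abs_zero]; exact h0
  · rw [packK_inr_inr, abs_zero]; exact h0

/-- [folklore] **A LOCAL BI-STENCIL FAMILY, UNPACKED, IS A FIELD–MULTIPLIER FAMILY** at blocking `N`, SAME constant and rate (the three `ℓ¹` words coincide). -/
theorem locStencilFM_rowsK₂ (hB : LocStencil₂ B C δ) (N : ℕ) : LocStencilFM N (rowsK₂ N B) C δ := by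
  have hC : 0 ≤ C := hB.nonneg
  intro κ u ρ w u' x a b
  have h0 : (0 : ℝ) ≤ C * Real.exp (-δ * l1 (u - (N : ℤ) • w)) * Real.exp (-δ * (l1 (u' - u) + l1 (x - u))) := by positivity
  rcases a with κ' | ν
  · rcases b with α | ν'
    · rw [rowsK₂_inl_inl]
      refine (hB κ u κ' u' x ((N : ℤ) • w) (Sum.inl α) (Sum.inr ρ)).trans (le_of_eq ?_)
      rw [l1_sub_symm ((N : ℤ) • w) u]; simp only [mul_add, Real.exp_add]; ring
    · rw [rowsK₂_inl_inr, abs_zero]; exact h0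
  · rw [rowsK₂_inr, abs_zero]; exact h0

/-- [folklore] **A FIELD–MULTIPLIER FAMILY, PACKED WITH mf SIGN `ε`, IS A LOCAL BI-STENCIL FAMILY** at blocking `N` (`1 ≤ N`), constant `(1 + |ε|)·C`, same rate. -/
theorem locStencil₂_packK₂ (hT : LocStencilFM N T₂ C δ) (hN : 1 ≤ N) (ε : ℝ) : LocStencil₂ (packK₂ N ε T₂) ((1 + |ε|) * C) δ := by
  have hC : 0 ≤ C := hT.nonneg
  have hε : 0 ≤ |ε| := abs_nonneg ε
  intro κ u κ' u' x z a b
  have h0 : (0 : ℝ) ≤ (1 + |ε|) * C * Real.exp (-δ * l1 (u' - u)) * Real.exp (-δ * (l1 (x - u) + l1 (z - u))) := by positivity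
  have hC1 : C ≤ (1 + |ε|) * C := by nlinarith
  have hC2 : |ε| * C ≤ (1 + |ε|) * C := by nlinarith
  rcases a with α | ρ <;> rcases b with α' | ρ'
  · rw [packK₂_inl_inl, abs_zero]; exact h0
  · rw [packK₂_inl_inr]
    split_ifs with hz
    · have ez : (N : ℤ) • blk N z = z := zsmul_blk_of_off_eq_zero hN hz
      have h := hT κ u ρ' (blk N z) u' x (Sum.inl κ') (Sum.inl α)
      rw [ez] at h
      refine h.trans ?_
      have e : C * Real.exp (-δ * l1 (u - z)) * Real.exp (-δ * (l1 (u' - u) + l1 (x - u)))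
          = C * (Real.exp (-δ * l1 (u' - u)) * Real.exp (-δ * (l1 (x - u) + l1 (z - u)))) := by
        rw [l1_sub_symm u z]; simp only [mul_add, Real.exp_add]; ring
      rw [e, mul_assoc ((1 + |ε|) * C)]
      exact mul_le_mul_of_nonneg_right hC1 (by positivity)
    · rw [abs_zero]; exact h0
  · rw [packK₂_inr_inl]
    split_ifs with hx
    · have ex : (N : ℤ) • blk N x = x := zsmul_blk_of_off_eq_zero hN hx
      have h := hT κ u ρ (blk N x) u' z (Sum.inl κ') (Sum.inl α')
      rw [ex] at h
      rw [abs_mul]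
      refine (mul_le_mul_of_nonneg_left h hε).trans ?_
      have e : |ε| * (C * Real.exp (-δ * l1 (u - x)) * Real.exp (-δ * (l1 (u' - u) + l1 (z - u))))
          = |ε| * C * (Real.exp (-δ * l1 (u' - u)) * Real.exp (-δ * (l1 (x - u) + l1 (z - u)))) := by
        rw [l1_sub_symm u x]; simp only [mul_add, Real.exp_add]; ring
      rw [e, mul_assoc ((1 + |ε|) * C)]
      exact mul_le_mul_of_nonneg_right hC2 (by positivity)
    · rw [mul_zero, abs_zero]; exact h0
  · rw [packK₂_inr_inr, abs_zero]; exact h0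

/-- [folklore] **(TV) UNPACKS**: block-translation covariance of `V` at blocking `N` makes `rowsK N V` a translation-covariant `H`-shaped family (D3-translate's (T-H) shape). -/
theorem rowsK_translate (hVt : ∀ (κ : Fin (d + 1)) (u t : Site (d + 1)), V κ (u + (N : ℤ) • t) = shiftK (-((N : ℤ) • t)) (V κ u))
    (ρ : Fin (d + 1)) (w t : Site (d + 1)) : rowsK N V ρ (w + t) = shiftK (-((N : ℤ) • t)) (rowsK N V ρ w) := by
  funext u x a b
  rcases a with κ | ν
  · rcases b with α | ν'
    · show V κ u x ((N : ℤ) • (w + t)) (Sum.inl α) (Sum.inr ρ) = V κ (u + -((N : ℤ) • t)) (x + -((N : ℤ) • t)) ((N : ℤ) • w) (Sum.inl α) (Sum.inr ρ)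
      have h := hVt κ (u + -((N : ℤ) • t)) t
      rw [neg_add_cancel_right] at h
      rw [h]
      show V κ (u + -((N : ℤ) • t)) (x + -((N : ℤ) • t)) ((N : ℤ) • (w + t) + -((N : ℤ) • t)) (Sum.inl α) (Sum.inr ρ) = _
      rw [smul_add, add_neg_cancel_right]
    · rfl
  · cases b <;> rfl

/-- [folklore] **A TRANSLATION-COVARIANT FAMILY PACKS TO A (TV)-COVARIANT TABLE** (an1's `packVH_translate`; `1 ≤ N`). -/
theorem packK_translate (hN : 1 ≤ N) (hT : ∀ (ρ : Fin (d + 1)) (w t : Site (d + 1)), T ρ (w + t) = shiftK (-((N : ℤ) • t)) (T ρ w))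
    (κ : Fin (d + 1)) (u t : Site (d + 1)) : packK N T κ (u + (N : ℤ) • t) = shiftK (-((N : ℤ) • t)) (packK N T κ u) := by
  refine packVH_translate (fun ρ w f f' => T ρ w f'.2 f.2 (Sum.inl f'.1) (Sum.inl f.1)) hN (fun μ y s f f' => ?_) κ u t
  show T μ (y + s) (f'.2 + (N : ℤ) • s) (f.2 + (N : ℤ) • s) (Sum.inl f'.1) (Sum.inl f.1) = T μ y f'.2 f.2 (Sum.inl f'.1) (Sum.inl f.1)
  rw [hT μ y s]
  show T μ y (f'.2 + (N : ℤ) • s + -((N : ℤ) • s)) (f.2 + (N : ℤ) • s + -((N : ℤ) • s)) (Sum.inl f'.1) (Sum.inl f.1) = _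
  rw [add_neg_cancel_right, add_neg_cancel_right]

/-- [folklore] **(TB) UNPACKS** to D3-translate's (T-M₂) shape. -/
theorem rowsK₂_translate
    (hBt : ∀ (κ : Fin (d + 1)) (u : Site (d + 1)) (κ' : Fin (d + 1)) (u' t : Site (d + 1)),
      B κ (u + (N : ℤ) • t) κ' (u' + (N : ℤ) • t) = shiftK (-((N : ℤ) • t)) (B κ u κ' u'))
    (κ : Fin (d + 1)) (u : Site (d + 1)) (ρ : Fin (d + 1)) (w t : Site (d + 1)) :
    rowsK₂ N B κ (u + (N : ℤ) • t) ρ (w + t) = shiftK (-((N : ℤ) • t)) (rowsK₂ N B κ u ρ w) := by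
  funext u' x a b
  rcases a with κ' | ν
  · rcases b with α | ν'
    · show B κ (u + (N : ℤ) • t) κ' u' x ((N : ℤ) • (w + t)) (Sum.inl α) (Sum.inr ρ)
          = B κ u κ' (u' + -((N : ℤ) • t)) (x + -((N : ℤ) • t)) ((N : ℤ) • w) (Sum.inl α) (Sum.inr ρ)
      have h := hBt κ u κ' (u' + -((N : ℤ) • t)) t
      rw [neg_add_cancel_right] at h
      rw [h]
      show B κ u κ' (u' + -((N : ℤ) • t)) (x + -((N : ℤ) • t)) ((N : ℤ) • (w + t) + -((N : ℤ) • t)) (Sum.inl α) (Sum.inr ρ) = _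
      rw [smul_add, add_neg_cancel_right]
    · rfl
  · cases b <;> rfl

/-- [folklore] **A TRANSLATION-COVARIANT `M₂`-SHAPED FAMILY PACKS TO A (TB)-COVARIANT BI-TABLE** (`1 ≤ N`). -/
theorem packK₂_translate (hN : 1 ≤ N) (ε : ℝ)
    (hT : ∀ (κ : Fin (d + 1)) (u : Site (d + 1)) (ρ : Fin (d + 1)) (w t : Site (d + 1)),
      T₂ κ (u + (N : ℤ) • t) ρ (w + t) = shiftK (-((N : ℤ) • t)) (T₂ κ u ρ w))
    (κ : Fin (d + 1)) (u : Site (d + 1)) (κ' : Fin (d + 1)) (u' t : Site (d + 1)) :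
    packK₂ N ε T₂ κ (u + (N : ℤ) • t) κ' (u' + (N : ℤ) • t) = shiftK (-((N : ℤ) • t)) (packK₂ N ε T₂ κ u κ' u') := by
  funext x z a b
  have e1 : ∀ y : Site (d + 1), y + -((N : ℤ) • t) = y + (N : ℤ) • (-t) := fun y => by rw [smul_neg]
  have key : ∀ (y x₁ : Site (d + 1)) (α ρ : Fin (d + 1)),
      T₂ κ (u + (N : ℤ) • t) ρ (blk N y) (u' + (N : ℤ) • t) x₁ (Sum.inl κ') (Sum.inl α)
        = T₂ κ u ρ (blk N (y + -((N : ℤ) • t))) u' (x₁ + -((N : ℤ) • t)) (Sum.inl κ') (Sum.inl α) := by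
    intro y x₁ α ρ
    rw [e1 y, blk_add_smul hN]
    have h := hT κ u ρ (blk N y + -t) t
    rw [neg_add_cancel_right] at h
    rw [h]
    show T₂ κ u ρ (blk N y + -t) (u' + (N : ℤ) • t + -((N : ℤ) • t)) (x₁ + -((N : ℤ) • t)) (Sum.inl κ') (Sum.inl α) = _
    rw [add_neg_cancel_right]
  rcases a with α | ρ <;> rcases b with α' | ρ'
  · rfl
  · show packK₂ N ε T₂ κ (u + (N : ℤ) • t) κ' (u' + (N : ℤ) • t) x z (Sum.inl α) (Sum.inr ρ')
        = packK₂ N ε T₂ κ u κ' u' (x + -((N : ℤ) • t)) (z + -((N : ℤ) • t)) (Sum.inl α) (Sum.inr ρ')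
    rw [packK₂_inl_inr, packK₂_inl_inr]
    have hoff : off N (z + -((N : ℤ) • t)) = off N z := by rw [e1, off_add_smul]
    rw [hoff]
    split_ifs with hz
    · rw [key z]
    · rfl
  · show packK₂ N ε T₂ κ (u + (N : ℤ) • t) κ' (u' + (N : ℤ) • t) x z (Sum.inr ρ) (Sum.inl α')
        = packK₂ N ε T₂ κ u κ' u' (x + -((N : ℤ) • t)) (z + -((N : ℤ) • t)) (Sum.inr ρ) (Sum.inl α')
    rw [packK₂_inr_inl, packK₂_inr_inl]
    have hoff : off N (x + -((N : ℤ) • t)) = off N x := by rw [e1, off_add_smul]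
    rw [hoff]
    split_ifs with hx
    · rw [key x]
    · rfl
  · rfl

end Reslice

/-! ## §2 The letters of `V^{(m)}` -/

section First

variable {Lc : ℕ} [NeZero Lc] {q : Fin (d + 1) → Site (d + 1) → Fin (d + 1) → Site (d + 1) → ℝ} {Cq δ : ℝ}
  {V : Fin (d + 1) → Site (d + 1) → MKer (d + 1) (Fib d)} {CV : ℝ}

omit [NeZero Lc] in
/-- [folklore] Weakening the one-step weight's decay letter to half the rate. -/
theorem weight_half (hq : ∀ ρ w κ u, |q ρ w κ u| ≤ Cq * Real.exp (-δ * l1 (u - (Lc : ℤ) • w))) (hCq : 0 ≤ Cq) (hδ : 0 ≤ δ) :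
    ∀ ρ w κ u, |q ρ w κ u| ≤ Cq * Real.exp (-(δ / 2) * l1 (u - (Lc : ℤ) • w)) := fun ρ w κ u =>
  (hq ρ w κ u).trans (mul_le_mul_of_nonneg_left (Real.exp_le_exp.2 (by nlinarith [l1_nonneg (u - (Lc : ℤ) • w)])) hCq)

/-- [our object — bookkeeping] **EVERY COMPOSITE FIRST-ORDER BORDER TABLE IS A LOCAL STENCIL FAMILY** (`m ≥ 1`; SOME constant, SOME rate): `m = 1` is the one-step letter; for
`m ≥ 2`, (Lq) + the unpacked one-step letter (`vertexFamily_rowsK`) feed D3's `vertexFamily_HComp` at blocking `Lc^m`, and `locStencil_packK` re-slices. -/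
theorem locStencil_VComp (hq : ∀ ρ w κ u, |q ρ w κ u| ≤ Cq * Real.exp (-δ * l1 (u - (Lc : ℤ) • w))) (hCq : 0 ≤ Cq) (hδ : 0 < δ)
    (hV : LocStencil V CV δ) (lam : ℝ) {m : ℕ} (hm : 1 ≤ m) : ∃ C δ' : ℝ, 0 < δ' ∧ LocStencil (VComp Lc q lam V m) C δ' := by
  by_cases h1 : m = 1
  · subst h1
    exact ⟨CV, δ, hδ, by rw [VComp_one]; exact hV⟩
  · obtain ⟨m', rfl⟩ : ∃ m', m = m' + 1 := ⟨m - 1, by omega⟩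
    have hH : VertexFamily (rowsK Lc V) Lc CV (δ / 2) := vertexFamily_rowsK hV hδ.le Lc
    obtain ⟨C, δ', hδ', hX⟩ := vertexFamily_HComp (Lc := Lc) (weight_half hq hCq hδ.le) hCq (half_pos hδ) hH lam m'
    have hN : 1 ≤ Lc ^ (m' + 1) := Nat.one_le_pow _ _ (Nat.pos_of_ne_zero (NeZero.ne Lc))
    refine ⟨C, δ' / 2, half_pos hδ', ?_⟩
    rw [VComp_of_ne_one Lc q lam V h1]
    exact locStencil_packK hX hδ'.le hN

/-- [our object — bookkeeping] **(TV) AT BLOCKING `Lc^m`**: from (T-q) and the one-step (TV), `VComp … m κ (u + Lc^m•t) = shiftK (−Lc^m•t) (VComp … m κ u)` for every `m`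
(D3-translate's `HComp_translate` on the unpacked tensor, re-packed by `packK_translate`). -/
theorem VComp_translate
    (hq : ∀ (ρ : Fin (d + 1)) (w : Site (d + 1)) (κ : Fin (d + 1)) (u t : Site (d + 1)), q ρ (w + t) κ (u + (Lc : ℤ) • t) = q ρ w κ u)
    (hVt : ∀ (κ : Fin (d + 1)) (u t : Site (d + 1)), V κ (u + (Lc : ℤ) • t) = shiftK (-((Lc : ℤ) • t)) (V κ u)) (lam : ℝ) (m : ℕ)
    (κ : Fin (d + 1)) (u t : Site (d + 1)) :
    VComp Lc q lam V m κ (u + (((Lc ^ m : ℕ) : ℤ)) • t) = shiftK (-((((Lc ^ m : ℕ) : ℤ)) • t)) (VComp Lc q lam V m κ u) := by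
  by_cases h1 : m = 1
  · subst h1
    rw [VComp_one]
    have e : (((Lc ^ 1 : ℕ) : ℤ)) = (Lc : ℤ) := by push_cast; ring
    rw [e]; exact hVt κ u t
  · rw [VComp_of_ne_one Lc q lam V h1]
    have hN : 1 ≤ Lc ^ m := Nat.one_le_pow _ _ (Nat.pos_of_ne_zero (NeZero.ne Lc))
    exact packK_translate hN (fun ρ w s => HComp_translate Lc q lam (rowsK Lc V) hq (rowsK_translate hVt) m ρ w s) κ u t

end First

/-! ## §3 The letters of the second-order border table and of the second-order slot of record -/

section Second

variable {Lc : ℕ} [NeZero Lc] {q : Fin (d + 1) → Site (d + 1) → Fin (d + 1) → Site (d + 1) → ℝ} {Cq δ : ℝ} (ε : ℝ)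
  {V : Fin (d + 1) → Site (d + 1) → MKer (d + 1) (Fib d)} {CV : ℝ}
  {B : Fin (d + 1) → Site (d + 1) → Fin (d + 1) → Site (d + 1) → MKer (d + 1) (Fib d)} {CB : ℝ}

/-- [our object — bookkeeping] **EVERY COMPOSITE SECOND-ORDER BORDER TABLE IS A LOCAL BI-STENCIL FAMILY** (`m ≥ 1`): `m = 1` is the one-step letter; for `m ≥ 2`, (Lq) + the two
unpacked one-step letters feed D3-mixed's `locStencilFM_M2Comp` at blocking `Lc^m`, and `locStencil₂_packK₂` re-slices (constant `(1+|ε|)·C`). -/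
theorem locStencil₂_V₂Comp (hq : ∀ ρ w κ u, |q ρ w κ u| ≤ Cq * Real.exp (-δ * l1 (u - (Lc : ℤ) • w))) (hCq : 0 ≤ Cq) (hδ : 0 < δ)
    (hV : LocStencil V CV δ) (hB : LocStencil₂ B CB δ) (lam : ℝ) {m : ℕ} (hm : 1 ≤ m) :
    ∃ C δ' : ℝ, 0 < δ' ∧ LocStencil₂ (V₂Comp ε Lc q lam V B m) C δ' := by
  by_cases h1 : m = 1
  · subst h1
    exact ⟨CB, δ, hδ, by rw [V₂Comp_one]; exact hB⟩
  · obtain ⟨m', rfl⟩ : ∃ m', m = m' + 1 := ⟨m - 1, by omega⟩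
    have hH : VertexFamily (rowsK Lc V) Lc CV (δ / 2) := vertexFamily_rowsK hV hδ.le Lc
    have hM : LocStencilFM Lc (rowsK₂ Lc B) CB (δ / 2) := (locStencilFM_rowsK₂ hB Lc).mono (half_le_self hδ.le)
    obtain ⟨C, δ', hδ', hX⟩ := locStencilFM_M2Comp (Lc := Lc) (weight_half hq hCq hδ.le) hCq (half_pos hδ) hH hM lam 1 m'
    have hN : 1 ≤ Lc ^ (m' + 1) := Nat.one_le_pow _ _ (Nat.pos_of_ne_zero (NeZero.ne Lc))
    refine ⟨(1 + |ε|) * C, δ', hδ', ?_⟩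
    rw [V₂Comp_of_ne_one ε Lc q lam V B h1]
    exact locStencil₂_packK₂ hX hN ε

variable {S₂inf : Fin (d + 1) → Site (d + 1) → Fin (d + 1) → Site (d + 1) → MKer (d + 1) (Fib d)} {C₂ : ℝ}

/-- [our object — bookkeeping] **THE SECOND-ORDER SLOT OF RECORD AT LEVEL `m` IS A LOCAL BI-STENCIL FAMILY** (`m ≥ 1`): `m = 1` is the letter of `S₂∞`; for `m ≥ 2`,
`(S₂∞ − cB 1 • B) + cB m • V₂Comp … m` by `biLoc_sub` ∕ `biLoc_add` ∕ `biLoc_smul` at the minimum rate. -/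
theorem locStencil₂_S₂Comp (hq : ∀ ρ w κ u, |q ρ w κ u| ≤ Cq * Real.exp (-δ * l1 (u - (Lc : ℤ) • w))) (hCq : 0 ≤ Cq) (hδ : 0 < δ)
    (hV : LocStencil V CV δ) (hB : LocStencil₂ B CB δ) (hS₂ : LocStencil₂ S₂inf C₂ δ) (lam : ℝ) (cB : ℕ → ℝ) {m : ℕ} (hm : 1 ≤ m) :
    ∃ C δ' : ℝ, 0 < δ' ∧ LocStencil₂ (S₂Comp ε Lc q lam V B S₂inf cB m) C δ' := by
  by_cases h1 : m = 1
  · subst h1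
    exact ⟨C₂, δ, hδ, by rw [S₂Comp_one]; exact hS₂⟩
  · obtain ⟨C, δ', hδ', hX⟩ := locStencil₂_V₂Comp ε hq hCq hδ hV hB lam hm
    set r : ℝ := min δ δ' with hr
    have hr0 : 0 < r := lt_min hδ hδ'
    have hS' : LocStencil₂ S₂inf C₂ r := hS₂.mono (min_le_left _ _)
    have hB' : LocStencil₂ B CB r := hB.mono (min_le_left _ _)
    have hX' : LocStencil₂ (V₂Comp ε Lc q lam V B m) C r := hX.mono (min_le_right _ _)
    refine ⟨C₂ + |cB 1| * CB + |cB m| * C, r, hr0, fun κ u κ' u' => ?_⟩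
    rw [S₂Comp_of_ne_one ε Lc q lam V B S₂inf cB h1]
    have h1' := biLoc_sub (hS' κ u κ' u') (biLoc_smul (cB 1) (hB' κ u κ' u'))
    have h2' := biLoc_add h1' (biLoc_smul (cB m) (hX' κ u κ' u'))
    have e : C₂ * Real.exp (-r * l1 (u' - u)) + |cB 1| * (CB * Real.exp (-r * l1 (u' - u))) + |cB m| * (C * Real.exp (-r * l1 (u' - u)))
        = (C₂ + |cB 1| * CB + |cB m| * C) * Real.exp (-r * l1 (u' - u)) := by ring
    rw [e] at h2'
    exact h2'

/-- [our object — bookkeeping] **(TB) AT BLOCKING `Lc^m` FOR THE COMPOSITE SECOND-ORDER BORDER TABLE** (D3-translate's `M2Comp_translate` on the unpacked tensors). -/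
theorem V₂Comp_translate
    (hq : ∀ (ρ : Fin (d + 1)) (w : Site (d + 1)) (κ : Fin (d + 1)) (u t : Site (d + 1)), q ρ (w + t) κ (u + (Lc : ℤ) • t) = q ρ w κ u)
    (hVt : ∀ (κ : Fin (d + 1)) (u t : Site (d + 1)), V κ (u + (Lc : ℤ) • t) = shiftK (-((Lc : ℤ) • t)) (V κ u))
    (hBt : ∀ (κ : Fin (d + 1)) (u : Site (d + 1)) (κ' : Fin (d + 1)) (u' t : Site (d + 1)),
      B κ (u + (Lc : ℤ) • t) κ' (u' + (Lc : ℤ) • t) = shiftK (-((Lc : ℤ) • t)) (B κ u κ' u'))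
    (lam : ℝ) (m : ℕ) (κ : Fin (d + 1)) (u : Site (d + 1)) (κ' : Fin (d + 1)) (u' t : Site (d + 1)) :
    V₂Comp ε Lc q lam V B m κ (u + (((Lc ^ m : ℕ) : ℤ)) • t) κ' (u' + (((Lc ^ m : ℕ) : ℤ)) • t)
      = shiftK (-((((Lc ^ m : ℕ) : ℤ)) • t)) (V₂Comp ε Lc q lam V B m κ u κ' u') := by
  by_cases h1 : m = 1
  · subst h1
    rw [V₂Comp_one]
    have e : (((Lc ^ 1 : ℕ) : ℤ)) = (Lc : ℤ) := by push_cast; ring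
    rw [e]; exact hBt κ u κ' u' t
  · rw [V₂Comp_of_ne_one ε Lc q lam V B h1]
    have hN : 1 ≤ Lc ^ m := Nat.one_le_pow _ _ (Nat.pos_of_ne_zero (NeZero.ne Lc))
    exact packK₂_translate hN ε
      (fun κ₁ u₁ ρ w s => M2Comp_translate Lc q lam (rowsK Lc V) (rowsK₂ Lc B) 1 hq (rowsK_translate hVt) (rowsK₂_translate hBt) m κ₁ u₁ ρ w s) κ u κ' u' t

/-- [our object — bookkeeping] **(TB) AT BLOCKING `Lc^m` FOR THE SECOND-ORDER SLOT OF RECORD** (`m ≥ 1`; the m = 1 letter's own (TB) at blocking `Lc^m` displayed as `hS₂t`). -/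
theorem S₂Comp_translate
    (hq : ∀ (ρ : Fin (d + 1)) (w : Site (d + 1)) (κ : Fin (d + 1)) (u t : Site (d + 1)), q ρ (w + t) κ (u + (Lc : ℤ) • t) = q ρ w κ u)
    (hVt : ∀ (κ : Fin (d + 1)) (u t : Site (d + 1)), V κ (u + (Lc : ℤ) • t) = shiftK (-((Lc : ℤ) • t)) (V κ u))
    (hBt : ∀ (κ : Fin (d + 1)) (u : Site (d + 1)) (κ' : Fin (d + 1)) (u' t : Site (d + 1)),
      B κ (u + (Lc : ℤ) • t) κ' (u' + (Lc : ℤ) • t) = shiftK (-((Lc : ℤ) • t)) (B κ u κ' u'))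
    (lam : ℝ) (cB : ℕ → ℝ) {m : ℕ} (hm : 1 ≤ m)
    (hS₂t : ∀ (κ : Fin (d + 1)) (u : Site (d + 1)) (κ' : Fin (d + 1)) (u' t : Site (d + 1)),
      S₂inf κ (u + (((Lc ^ m : ℕ) : ℤ)) • t) κ' (u' + (((Lc ^ m : ℕ) : ℤ)) • t) = shiftK (-((((Lc ^ m : ℕ) : ℤ)) • t)) (S₂inf κ u κ' u'))
    (κ : Fin (d + 1)) (u : Site (d + 1)) (κ' : Fin (d + 1)) (u' t : Site (d + 1)) :
    S₂Comp ε Lc q lam V B S₂inf cB m κ (u + (((Lc ^ m : ℕ) : ℤ)) • t) κ' (u' + (((Lc ^ m : ℕ) : ℤ)) • t)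
      = shiftK (-((((Lc ^ m : ℕ) : ℤ)) • t)) (S₂Comp ε Lc q lam V B S₂inf cB m κ u κ' u') := by
  by_cases h1 : m = 1
  · subst h1
    rw [S₂Comp_one]
    exact hS₂t κ u κ' u' t
  · rw [S₂Comp_of_ne_one ε Lc q lam V B S₂inf cB h1]
    -- the one-step border's (TB) at blocking `Lc^m` (a multiple of `Lc`)
    have hBm : B κ (u + (((Lc ^ m : ℕ) : ℤ)) • t) κ' (u' + (((Lc ^ m : ℕ) : ℤ)) • t) = shiftK (-((((Lc ^ m : ℕ) : ℤ)) • t)) (B κ u κ' u') := by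
      obtain ⟨m', rfl⟩ : ∃ m', m = m' + 1 := ⟨m - 1, by omega⟩
      have e : (((Lc ^ (m' + 1) : ℕ) : ℤ)) • t = (Lc : ℤ) • ((((Lc ^ m' : ℕ) : ℤ)) • t) := by
        rw [smul_smul]; congr 1; push_cast; ring
      rw [e]; exact hBt κ u κ' u' _
    show (S₂inf κ (u + (((Lc ^ m : ℕ) : ℤ)) • t) κ' (u' + (((Lc ^ m : ℕ) : ℤ)) • t) - cB 1 • B κ (u + (((Lc ^ m : ℕ) : ℤ)) • t) κ' (u' + (((Lc ^ m : ℕ) : ℤ)) • t))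
        + cB m • V₂Comp ε Lc q lam V B m κ (u + (((Lc ^ m : ℕ) : ℤ)) • t) κ' (u' + (((Lc ^ m : ℕ) : ℤ)) • t)
      = shiftK (-((((Lc ^ m : ℕ) : ℤ)) • t)) ((S₂inf κ u κ' u' - cB 1 • B κ u κ' u') + cB m • V₂Comp ε Lc q lam V B m κ u κ' u')
    rw [hS₂t, hBm, V₂Comp_translate ε hq hVt hBt lam m]
    rfl

end Second

end Summit.QuantumFields.BalabanUV.Beta.FP.CompositeBorderTablesLetters

end
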